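import Mathlib
import Summits.KontsevichZagierPeriods.Zeta5Search.ClusterValuationPairs
import Summits.KontsevichZagierPeriods.Zeta5Search.DenomLaw.PathWeightBounds
import HarnessLib

/-!
# ζ(5) search — `C⋆` on a θ-cell by PROFILE: a finite check over the 5,040 vertex orderings, and the record ray's cells `14n < p < 15n`, `15n < p ≤ 16n`, `p > 16n`

Cell `pub-zeta5` (HONEST FRAMING: systematic search; no irrationality claim unless certified), TRACK «DENOM-LAW» D1 prover seat
(denom-prover-d1 g11, `HOME/denom-law/prover-d1/ATTEMPT-11.md` §8).  `C⋆_p(b) = cStar b p` (the PATH ACCOUNTING node's combinatorial datum: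
the largest weight of a Hamiltonian path of `K₇` — interior vertices whose parameter reaches `p`, edges whose pair block reaches `p`)
depends on `b` only through WHICH parameters and WHICH pair blocks reach `p`.  `cStar_le_of_profile` turns an upper bound on `C⋆` into a
finite check: if every parameter reaching `p` satisfies a decidable `Pl` and every pair block reaching `p` a decidable `Ph`, then `C⋆ ≤ K` as
soon as every ordering of the seven vertices has `(Pl, Ph)`-profile weight `≤ K` — one `decide` over `(List.finRange 7).permutations'`
(5,040 lists, ≈ 15 s in the kernel).  On Brown–Zudilin's record ray `b(n) = n·(41;17,…,11)` a θ-cell fixes the profile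
(`(17−i)·n ≥ p`, `(7+i+k)·n ≥ p`), giving `C⋆ ≤ 6` on `14n < p < 15n` and `C⋆ ≤ 5` on `15n < p ≤ 16n` (both attained: brute force); for
`p > 16n` the tree's `cStar_le_five_of_sorted` already gives `C⋆ ≤ 5`.  Pure combinatorics; nothing about irrationality.
-/

open Finset

namespace Summit.KontsevichZagierPeriods.Zeta5Search.DenomLaw.FirstPeriodKit

open Summit.KontsevichZagierPeriods.Zeta5Search.DenomLaw (Sorted7 BlockGe pathWeight cStar)
open Summit.KontsevichZagierPeriods.Zeta5Search.ClusterValuation (bRec)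

variable {b : ℕ → ℤ} {p : ℕ}

/-- **profile bound for one path**: if every parameter reaching `p` satisfies `Pl` and every pair block reaching `p` satisfies `Ph`, the
weight of the path `π` is at most its `(Pl, Ph)`-profile weight. -/
theorem pathWeight_le_profile (Pl : Fin 7 → Prop) (Ph : Fin 7 → Fin 7 → Prop) [DecidablePred Pl] [∀ i, DecidablePred (Ph i)]
    (hlong : ∀ i : Fin 7, (p : ℤ) ≤ b (i.val + 1) → Pl i)
    (hheavy : ∀ i k : Fin 7, (p : ℤ) ≤ b 0 - b (i.val + 1) - b (k.val + 1) → Ph i k) (π : Equiv.Perm (Fin 7)) :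
    pathWeight b p π ≤
      ((univ : Finset (Fin 5)).filter fun t => Pl (π ⟨t.val + 1, by omega⟩)).card +
      ((univ : Finset (Fin 6)).filter fun t => Ph (π ⟨t.val, by omega⟩) (π ⟨t.val + 1, by omega⟩)).card := by
  unfold pathWeight
  refine add_le_add (card_le_card fun t ht => ?_) (card_le_card fun t ht => ?_)
  · simp only [mem_filter, mem_univ, true_and] at ht ⊢
    exact hlong _ ht
  · simp only [mem_filter, mem_univ, true_and] at ht ⊢
    exact hheavy _ _ ht

/-- The vertex sequence of `π` as a list is a permutation of `finRange 7`. -/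
theorem ofFn_mem_permutations' (π : Equiv.Perm (Fin 7)) : List.ofFn ⇑π ∈ (List.finRange 7).permutations' := by
  rw [List.mem_permutations']
  refine List.perm_of_nodup_nodup_toFinset_eq (List.nodup_ofFn.mpr π.injective) (List.nodup_finRange 7) ?_
  ext x
  simp only [List.mem_toFinset, List.mem_ofFn, List.mem_finRange, iff_true]
  exact ⟨π.symm x, by simp⟩

/-- Reading the list back: `(ofFn π).getD t 0 = π t`. -/
theorem getD_ofFn_perm (π : Equiv.Perm (Fin 7)) (t : ℕ) (ht : t < 7) : (List.ofFn ⇑π).getD t 0 = π ⟨t, ht⟩ := by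
  rw [List.getD_eq_getElem _ _ (by simpa using ht), List.getElem_ofFn]

/-- **`C⋆` by profile**: under the profile hypotheses, `C⋆ ≤ K` follows from the finite check that every ordering of the seven vertices has
profile weight `≤ K` (the hypothesis `hdec`, discharged by `decide +kernel` for concrete `Pl`, `Ph`, `K`). -/
theorem cStar_le_of_profile (Pl : Fin 7 → Prop) (Ph : Fin 7 → Fin 7 → Prop) [DecidablePred Pl] [∀ i, DecidablePred (Ph i)] (K : ℕ)
    (hlong : ∀ i : Fin 7, (p : ℤ) ≤ b (i.val + 1) → Pl i)
    (hheavy : ∀ i k : Fin 7, (p : ℤ) ≤ b 0 - b (i.val + 1) - b (k.val + 1) → Ph i k)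
    (hdec : ((List.finRange 7).permutations'.all fun l : List (Fin 7) => decide (
      ((univ : Finset (Fin 5)).filter fun t => Pl (l.getD (t.val + 1) 0)).card +
      ((univ : Finset (Fin 6)).filter fun t => Ph (l.getD t.val 0) (l.getD (t.val + 1) 0)).card ≤ K)) = true) :
    cStar b p ≤ K := by
  refine Finset.sup_le fun π _ => (pathWeight_le_profile Pl Ph hlong hheavy π).trans ?_
  have h := of_decide_eq_true (List.all_eq_true.1 hdec _ (ofFn_mem_permutations' π))
  have e1 : ((univ : Finset (Fin 5)).filter fun t => Pl ((List.ofFn ⇑π).getD (t.val + 1) 0)) =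
      ((univ : Finset (Fin 5)).filter fun t => Pl (π ⟨t.val + 1, by omega⟩)) :=
    filter_congr fun t _ => by rw [getD_ofFn_perm π (t.val + 1) (by omega)]
  have e2 : ((univ : Finset (Fin 6)).filter fun t => Ph ((List.ofFn ⇑π).getD t.val 0) ((List.ofFn ⇑π).getD (t.val + 1) 0)) =
      ((univ : Finset (Fin 6)).filter fun t => Ph (π ⟨t.val, by omega⟩) (π ⟨t.val + 1, by omega⟩)) :=
    filter_congr fun t _ => by rw [getD_ofFn_perm π t.val (by omega), getD_ofFn_perm π (t.val + 1) (by omega)]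
  rw [e1, e2] at h
  exact h

/-! ## The record ray's cells -/

/-- The record ray's parameters: `bRec n (i+1) = (17 − i)·n` for `i < 7`. -/
theorem bRec_param (n : ℕ) (i : Fin 7) : bRec n (i.val + 1) = (17 - (i.val : ℤ)) * n := by
  fin_cases i <;> simp [bRec] <;> ring

/-- The record ray's pair blocks: `41n − (17−i)n − (17−k)n = (7 + i + k)·n`. -/
theorem bRec_block (n : ℕ) (i k : Fin 7) : bRec n 0 - bRec n (i.val + 1) - bRec n (k.val + 1) = (7 + (i.val : ℤ) + k.val) * n := by
  rw [bRec_param, bRec_param]; simp [bRec]; ring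

/-- **`C⋆ ≤ 6` on the record cell `14n < p < 15n`** (longs among `17n,16n,15n`; heavy pair blocks `(7+i+k)n ≥ p ⇒ i + k ≥ 8`; attained). -/
theorem cStar_bRec_le_six {n p : ℕ} (hp : 14 * n < p) : cStar (bRec n) p ≤ 6 := by
  refine cStar_le_of_profile (fun i : Fin 7 => i.val ≤ 2) (fun i k : Fin 7 => 8 ≤ i.val + k.val) 6 ?_ ?_ (by decide +kernel)
  · intro i hi
    rw [bRec_param] at hi
    have : (i.val : ℤ) < 7 := by exact_mod_cast i.isLt
    by_contra hc
    push Not at hc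
    have h3 : (3 : ℤ) ≤ i.val := by exact_mod_cast hc
    nlinarith
  · intro i k hik
    rw [bRec_block] at hik
    by_contra hc
    push Not at hc
    have h7 : (i.val : ℤ) + k.val ≤ 7 := by exact_mod_cast (by omega : i.val + k.val ≤ 7)
    nlinarith

/-- **`C⋆ ≤ 5` on the record cell `15n < p`** below `16n` too (longs among `17n,16n`; heavy `i + k ≥ 9`; attained on `15n < p ≤ 16n`). -/
theorem cStar_bRec_le_five' {n p : ℕ} (hp : 15 * n < p) : cStar (bRec n) p ≤ 5 := by
  refine cStar_le_of_profile (fun i : Fin 7 => i.val ≤ 1) (fun i k : Fin 7 => 9 ≤ i.val + k.val) 5 ?_ ?_ (by decide +kernel)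
  · intro i hi
    rw [bRec_param] at hi
    by_contra hc
    push Not at hc
    have h2 : (2 : ℤ) ≤ i.val := by exact_mod_cast hc
    nlinarith
  · intro i k hik
    rw [bRec_block] at hik
    by_contra hc
    push Not at hc
    have h8 : (i.val : ℤ) + k.val ≤ 8 := by exact_mod_cast (by omega : i.val + k.val ≤ 8)
    nlinarith

end Summit.KontsevichZagierPeriods.Zeta5Search.DenomLaw.FirstPeriodKit
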